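import Literature.NumberTheory.Automorphic.LocalOrbitalIntegralIndicator   -- ★ `descConj_indicator`, `integral_descConj_indicator`, `measure_preimage_descConj_pos`
import Mathlib.LinearAlgebra.Matrix.Block
import HarnessLib

/-!
# RANK «orbit separation»: indicator orbital integrals vanish off the orbit; the reference matrix over a finite set of classes is invertible

Topic `NumberTheory/Automorphic`; namespace `Literature.NumberTheory.Automorphic`.  THEOREMS ONLY (no definition, no instance, no notation, no named fact, no `sorry`);
generic topological group `G`.  Cell `pub/hodgecm-mathlib`, crux H413 = `stmt-HodgeConjecture-24833`, road «S3-tree», organ ‹RANK› «ORBIT SEPARATION AT LEVEL 2» (architect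
A-p16 (g29) A-84 (2) ∕ A-87 (1), A-p16 (g30) A-88 (3) «=»; holder F0P3a-p08 (g17), second B-p14 (g36); reader ref5 R-97).  Builds on ★ `LocalOrbitalIntegralIndicator`
(`descConj_indicator`, `integral_descConj_indicator`, `measure_preimage_descConj_pos` — imported, not restated) and adds what the RANK fold needs: (§1) the orbital
integral of `1_T` VANISHES when the orbit misses `T` (no measure theory); the RAO CLAUSE (integrability of the orbital integrand of `1_T`) gives FINITE trace measure
at a NON-closed (unipotent) class, where ★ `measure_preimage_descConj_lt_top` (closed classes) does not apply; hence `Φ ≠ 0` when `T` is open and meets the class;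
`ConjClasses` ∕ `OrbitalMeasureFamily` wrappers; (§2) a matrix vanishing above the diagonal of an injective rank with non-zero diagonal has `det ≠ 0`; (§3) the
ABSTRACT RANK HEAD over the `S` ∕ `mU` ∕ «admissible on `S`» ∕ Rao-clause texts of ★ `ShalikaGermExpansionNonsplit` (p846293) VERBATIM: for compact open pieces
`P u` meeting the class `u ∈ S` and an injective rank `b` on `S` with «class `u` misses `P u′` when `b u < b u′`», `det (classOrbitalIntegral mU 1_{P u′} u)_{u,u′ ∈ S} ≠ 0`.
The U(3) instantiation at an unramified non-split place (classes `1, tv⁻, tv⁺, reg`; level-2 pieces inside `K(2), T⁻, T⁺, R`; separation by ★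
`UnitaryThreeTransvectionClassValuation`) is the consumer's step.  Written by F0P3a-p08 (g17).  HONEST LABEL: HC_CM is proved only modulo the printed citations (the
2 remaining named inputs hLiu418, h413) until rung 0 closes; nothing printed is asserted.

* §1 **`orbitalIntegral_indicator_eq_zero_of_forall_not_mem`**, **`measure_preimage_descConj_lt_top_of_integrable`** (Rao ⇒ finite), `orbitalIntegral_indicator_ne_zero`,
  `classOrbitalIntegral_indicator_eq_zero_of_forall_not_mem`, `classOrbitalIntegral_indicator_ne_zero`.
* §2 `det_ne_zero_of_lowerTriangular`, **`det_ne_zero_of_rank_lt`**.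
* §3 **`det_classOrbitalIntegral_indicator_ne_zero`** — the RANK head.

## References
* [Rogawski1990] J. D. Rogawski, *Automorphic Representations of Unitary Groups in Three Variables*, Ann. of Math. Stud. 123 (1990), §8.1 pp. 112–114.
* [HarishChandra1999AdmissibleDistributions] Harish-Chandra, *Admissible Invariant Distributions on Reductive p-adic Groups*, AMS ULS 16 (1999), §3.1 p. 17.
-/

set_option autoImplicit false

open MeasureTheory Set
open Literature.MeasureTheory.Group Literature.NumberTheory.Rogawski1990

namespace Literature.NumberTheory.Automorphic

/-! ## §1 Orbital integrals of indicator pieces -/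

section Indicator

variable {G : Type*} [Group G] [TopologicalSpace G] [IsTopologicalGroup G] (γ : G)
  [MeasurableSpace (G ⧸ Subgroup.centralizer ({γ} : Set G))] [BorelSpace (G ⧸ Subgroup.centralizer ({γ} : Set G))]
  (m : Measure (G ⧸ Subgroup.centralizer ({γ} : Set G))) (T : Set G)

omit [TopologicalSpace G] [IsTopologicalGroup G] [BorelSpace (G ⧸ Subgroup.centralizer ({γ} : Set G))] in
/-- **VANISHING OFF THE ORBIT**: if NO conjugate of `γ` lies in `T` then `Φ_γ^m(1_T) = 0` (the orbital integrand is identically zero — no measure theory).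
[cite: Rogawski1990, §8.1 p. 112] -/
theorem orbitalIntegral_indicator_eq_zero_of_forall_not_mem (hT : ∀ y : G, y * γ * y⁻¹ ∉ T) : orbitalIntegral γ (T.indicator fun _ => (1 : ℂ)) m = 0 := by
  rw [orbitalIntegral_eq_integral_descConj, descConj_indicator]
  have hempty : descConj γ (Subgroup.centralizer ({γ} : Set G)) (fun _ hg => Subgroup.mem_centralizer_singleton_iff.1 hg) id ⁻¹' T = ∅ := by
    ext q
    simp only [Set.mem_preimage, Set.mem_empty_iff_false, iff_false]
    induction q using QuotientGroup.induction_on with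
    | H y => rw [descConj_mk]; exact hT y
  rw [hempty, Set.indicator_empty]
  exact integral_zero _ _

omit [TopologicalSpace G] [IsTopologicalGroup G] [BorelSpace (G ⧸ Subgroup.centralizer ({γ} : Set G))] in
/-- **RAO CLAUSE ⇒ FINITE TRACE MEASURE** (any class, closed or not): if the orbital integrand of `1_T` is `m`-integrable and the trace set `{yC(γ) ∣ y γ y⁻¹ ∈ T}` is
measurable, the trace set has finite `m`-measure (cf. ★ `measure_preimage_descConj_lt_top`, which needs the class CLOSED). [cite: HarishChandra1999AdmissibleDistributions, §3.1 p. 17] -/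
theorem measure_preimage_descConj_lt_top_of_integrable
    (hS : MeasurableSet (descConj γ (Subgroup.centralizer ({γ} : Set G)) (fun _ hg => Subgroup.mem_centralizer_singleton_iff.1 hg) id ⁻¹' T))
    (hint : Integrable (descConj γ (Subgroup.centralizer ({γ} : Set G)) (fun _ hg => Subgroup.mem_centralizer_singleton_iff.1 hg) (T.indicator fun _ => (1 : ℂ))) m) :
    m (descConj γ (Subgroup.centralizer ({γ} : Set G)) (fun _ hg => Subgroup.mem_centralizer_singleton_iff.1 hg) id ⁻¹' T) < ⊤ := by
  rw [descConj_indicator, integrable_indicator_iff hS] at hint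
  have h := (integrableOn_const_iff (C := (1 : ℂ))).1 hint
  simpa using h

/-- **NON-VANISHING ON THE ORBIT**: for an open `T` whose trace set has positive finite `m`-measure, `Φ_γ^m(1_T) ≠ 0` (it is the positive real `m{…}`; ★
`integral_descConj_indicator`). [cite: HarishChandra1999AdmissibleDistributions, §3.1 p. 17] -/
theorem orbitalIntegral_indicator_ne_zero (hTo : IsOpen T)
    (hpos : 0 < m (descConj γ (Subgroup.centralizer ({γ} : Set G)) (fun _ hg => Subgroup.mem_centralizer_singleton_iff.1 hg) id ⁻¹' T))
    (hfin : m (descConj γ (Subgroup.centralizer ({γ} : Set G)) (fun _ hg => Subgroup.mem_centralizer_singleton_iff.1 hg) id ⁻¹' T) < ⊤) :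
    orbitalIntegral γ (T.indicator fun _ => (1 : ℂ)) m ≠ 0 := by
  rw [orbitalIntegral_eq_integral_descConj, integral_descConj_indicator γ m hTo, Complex.real_smul, mul_one, Ne, Complex.ofReal_eq_zero]
  exact (ENNReal.toReal_pos hpos.ne' hfin.ne).ne'

end Indicator

section ClassIndicator

variable {G : Type*} [Group G] [TopologicalSpace G] [IsTopologicalGroup G] [∀ γ : G, MeasurableSpace (G ⧸ Subgroup.centralizer ({γ} : Set G))]
  [∀ γ : G, BorelSpace (G ⧸ Subgroup.centralizer ({γ} : Set G))] (mU : OrbitalMeasureFamily G) (T : Set G)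

omit [TopologicalSpace G] [IsTopologicalGroup G] [∀ γ : G, BorelSpace (G ⧸ Subgroup.centralizer ({γ} : Set G))] in
/-- **Class form of the vanishing**: if the conjugacy class `c` does not meet `T` then `classOrbitalIntegral mU 1_T c = 0`. [cite: Rogawski1990, §8.1 p. 112] -/
theorem classOrbitalIntegral_indicator_eq_zero_of_forall_not_mem (c : ConjClasses G) (hT : ∀ g : G, ConjClasses.mk g = c → g ∉ T) :
    classOrbitalIntegral mU (T.indicator fun _ => (1 : ℂ)) c = 0 := by
  rw [classOrbitalIntegral_eq]
  refine orbitalIntegral_indicator_eq_zero_of_forall_not_mem _ _ _ fun y => hT _ ?_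
  have hc : ConjClasses.mk (Quotient.out c) = c := by rw [← ConjClasses.quotient_mk_eq_mk, Quotient.out_eq]
  calc ConjClasses.mk (y * Quotient.out c * y⁻¹) = ConjClasses.mk (Quotient.out c) :=
        ConjClasses.mk_eq_mk_iff_isConj.2 (isConj_iff.2 ⟨y, rfl⟩).symm
    _ = c := hc

/-- **Class form of the non-vanishing**: open `T`, positive finite trace measure at the representative ⇒ `classOrbitalIntegral mU 1_T c ≠ 0`.
[cite: HarishChandra1999AdmissibleDistributions, §3.1 p. 17] -/
theorem classOrbitalIntegral_indicator_ne_zero (c : ConjClasses G) (hTo : IsOpen T)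
    (hpos : 0 < mU c (descConj (Quotient.out c : G) (Subgroup.centralizer ({(Quotient.out c : G)} : Set G))
      (fun _ hg => Subgroup.mem_centralizer_singleton_iff.1 hg) id ⁻¹' T))
    (hfin : mU c (descConj (Quotient.out c : G) (Subgroup.centralizer ({(Quotient.out c : G)} : Set G))
      (fun _ hg => Subgroup.mem_centralizer_singleton_iff.1 hg) id ⁻¹' T) < ⊤) :
    classOrbitalIntegral mU (T.indicator fun _ => (1 : ℂ)) c ≠ 0 := by
  rw [classOrbitalIntegral_eq]
  exact orbitalIntegral_indicator_ne_zero _ _ _ hTo hpos hfin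

end ClassIndicator

/-! ## §2 A triangular reference matrix is invertible -/

/-- **A matrix vanishing above the diagonal with non-zero diagonal entries has non-zero determinant** (over a field; Mathlib `Matrix.det_of_lowerTriangular`).
[cite: Rogawski1990, §8.1 p. 112] -/
theorem det_ne_zero_of_lowerTriangular {n : Type*} [Fintype n] [DecidableEq n] [LinearOrder n] {F : Type*} [Field F] (A : Matrix n n F)
    (hupper : ∀ i j, i < j → A i j = 0) (hdiag : ∀ i, A i i ≠ 0) : A.det ≠ 0 := by
  have htri : A.BlockTriangular OrderDual.toDual := fun i j hij => hupper i j (by simpa using hij)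
  rw [Matrix.det_of_lowerTriangular A htri]
  exact Finset.prod_ne_zero_iff.2 fun i _ => hdiag i

/-- **Rank-function form**: if `b : n → ℕ` is injective, `A i j = 0` whenever `b i < b j`, and the diagonal entries are non-zero, then `det A ≠ 0` (pull the linear
order back along `b`) — the form the RANK head uses (`b` = position of a class in the closure order). [cite: Rogawski1990, §8.1 p. 112] -/
theorem det_ne_zero_of_rank_lt {n : Type*} [Fintype n] [DecidableEq n] {F : Type*} [Field F] (A : Matrix n n F) (b : n → ℕ) (hb : Function.Injective b)
    (hupper : ∀ i j, b i < b j → A i j = 0) (hdiag : ∀ i, A i i ≠ 0) : A.det ≠ 0 := by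
  letI : LinearOrder n := LinearOrder.lift' b hb
  exact det_ne_zero_of_lowerTriangular A (fun i j hij => hupper i j hij) hdiag

/-! ## §3 The RANK head: the reference matrix over `S` has non-zero determinant -/

section Head

variable {G : Type*} [Group G] [TopologicalSpace G] [IsTopologicalGroup G] [SigmaCompactSpace G]
  [∀ γ : G, MeasurableSpace (G ⧸ Subgroup.centralizer ({γ} : Set G))] [∀ γ : G, BorelSpace (G ⧸ Subgroup.centralizer ({γ} : Set G))]

open scoped Classical in
/-- **RANK — ORBIT SEPARATION (abstract head).**  Let `S` be a finite set of conjugacy classes of `G` (`G` σ-compact), `mU` an orbital-measure family ADMISSIBLE ON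
`S` (non-zero, `G`-invariant, finite on compacts at the classes of `S`) satisfying the RAO CLAUSE (every `C_c^∞` orbital integrand at `u ∈ S` is `mU u`-integrable) —
the texts of ★ `ShalikaGermExpansionNonsplit` verbatim.  Let `P u` (`u ∈ S`) be compact open (closed) pieces with `P u` meeting the class `u`, and `b` a rank, injective
on `S`, such that the class `u` misses `P u′` whenever `b u < b u′`.  Then the reference matrix `(classOrbitalIntegral mU 1_{P u′} u)_{u,u′ ∈ S}` has non-zero determinant:
it vanishes above the diagonal (§1) and its diagonal entries are non-zero (trace set open and non-empty ⇒ positive measure by ★ `measure_preimage_descConj_pos`; finite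
measure by the Rao clause, §1). [cite: Rogawski1990, §8.1 p. 112] [cite: HarishChandra1999AdmissibleDistributions, §3.1 p. 17] -/
theorem det_classOrbitalIntegral_indicator_ne_zero (S : Finset (ConjClasses G)) (mU : OrbitalMeasureFamily G)
    (hmU : mU.IsAdmissibleOn (fun γ => (ConjClasses.mk γ) ∈ S))
    (hRao : ∀ u ∈ S, ∀ f : G → ℂ, IsLocSmooth f →
      Integrable (descConj (Quotient.out u : G) (Subgroup.centralizer ({(Quotient.out u : G)} : Set G))
        (fun _ hg => Subgroup.mem_centralizer_singleton_iff.1 hg) f) (mU u))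
    (P : ConjClasses G → Set G) (hPo : ∀ u ∈ S, IsOpen (P u)) (hPc : ∀ u ∈ S, IsCompact (P u)) (hPcl : ∀ u ∈ S, IsClosed (P u))
    (hPx : ∀ u ∈ S, ∃ x ∈ P u, ConjClasses.mk x = u)
    (b : ConjClasses G → ℕ) (hb : Set.InjOn b S)
    (hsep : ∀ u ∈ S, ∀ u' ∈ S, b u < b u' → ∀ y ∈ P u', ConjClasses.mk y ≠ u) :
    (Matrix.of fun u u' : S => classOrbitalIntegral mU ((P u').indicator fun _ => (1 : ℂ)) u).det ≠ 0 := by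
  refine det_ne_zero_of_rank_lt _ (fun u : S => b u) (fun u u' h => Subtype.ext (hb u.2 u'.2 h)) (fun u u' hlt => ?_) (fun u => ?_)
  · -- above the diagonal: the class `u` misses the piece `P u'`
    rw [Matrix.of_apply]
    exact classOrbitalIntegral_indicator_eq_zero_of_forall_not_mem mU (P u') u fun g hg hgP => hsep u u.2 u' u'.2 hlt g hgP hg
  · -- diagonal: positive finite trace measure
    rw [Matrix.of_apply]
    have hout : ConjClasses.mk (Quotient.out (u : ConjClasses G)) = (u : ConjClasses G) := by
      rw [← ConjClasses.quotient_mk_eq_mk, Quotient.out_eq]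
    obtain ⟨hm0, hinv, -⟩ := hmU u (show ConjClasses.mk (Quotient.out (u : ConjClasses G)) ∈ S by rw [hout]; exact u.2)
    obtain ⟨x, hxP, hxu⟩ := hPx u u.2
    obtain ⟨y, hy⟩ := isConj_iff.1 (ConjClasses.mk_eq_mk_iff_isConj.1 (hout.trans hxu.symm))
    have hS : MeasurableSet (descConj (Quotient.out (u : ConjClasses G)) (Subgroup.centralizer ({(Quotient.out (u : ConjClasses G) : G)} : Set G))
        (fun _ hg => Subgroup.mem_centralizer_singleton_iff.1 hg) id ⁻¹' P u) :=
      ((hPo u u.2).preimage (continuous_descConj_id _ _ _)).measurableSet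
    exact classOrbitalIntegral_indicator_ne_zero mU (P u) u (hPo u u.2)
      (measure_preimage_descConj_pos _ (mU u) hm0 (hPo u u.2) ⟨y, hy.symm ▸ hxP⟩)
      (measure_preimage_descConj_lt_top_of_integrable _ (mU u) (P u) hS
        (hRao u u.2 _ (isLocSmooth_indicator (hPo u u.2) (hPcl u u.2) (hPc u u.2))))

end Head

end Literature.NumberTheory.Automorphic
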